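import Summits.QuantumFields.YangMills.Theorems.UnitScaleTiltProp8HalvingQuarterMatrix
import Summits.QuantumFields.YangMills.Theorems.UnitScaleTiltProp8FlatCubeQContraction
import HarnessLib

/-!
# Route `UnitScaleTilt`, crux K1 child «MinimiserStabilityRegPr» (stmt-QuantumFields-19200), registered stub V2′ `stub_halvingStep`
# (skeletons v8 5b4e846794b80374 / v10 `BirthV10`) — **(164) WITH THE INTERIOR NEAR CLASS**: the NEAR index bonds are the top-level bonds with BOTH end-points in
# the top cube `□_k^{(k)}` ([Balaban1985RegularSpaces] (1.31) FIRST case, [Balaban1985Variational] (154) first case: «⟨x, x′⟩ ∈ Λ′_j, x, x′ ∈ Λ′_j» — there the datum fed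
# to `H` is the log datum of the constraint data and is `u`-FREE), every other index bond (lower level, OR top-level CROSSING the boundary of `□_k`, where (1.31)'s
# second case brings the `u`-rotation `R₀u` and only the (155)-size `O(ε₀)` is available) is FAR: at distance `≥ ρ − r₀ − 1` from the evaluation bond

Cell `ym3-torus` (HUMAN RULING D-0037, YM ladder rung R3 — continuum SU(2) YM₃ on the torus is a RUNG, not the Clay problem), width seat
`ym-ust-19200-w3` gen 2 (D-0149).  `--supports stmt-QuantumFields-19200 --as helper`; def-free, 0 sorry, standard axioms.  LOCATED CORRECTION of this seat's own
package (`HalvingAssembly`, p595996/p596205): its (160)-near clause `‖B(c)‖ ≤ C₁ε₁(d + 1)` was asked of ALL top-level index bonds, but a top-level bond crossing `∂□_k`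
has a `u`-dependent datum of size `O(ε₀)` only ([Balaban1985Variational] (155)), so that clause is unsatisfiable there as typed; the fix is the near class of THIS
file — crossing bonds join the far class, where (155) is exactly what is asked.

WHAT THIS FILE PROVES (no definition, no sorry; `D := cubeSeqM x₀ k hk ρ S M hM`, resp. `cubeSeqMT3 F n K x₀ ρ S M hM`, `k = K − n ≥ 1`):
* §1 **`distBI_ge_of_top_not_interior`** — a TOP-LEVEL index bond with an end-point outside `□_k^{(k)}` is at `distBI ≥ ρ − r₀ − 1` from every fine bond whose
  `k`-block is within `r₀` of the centre block (that end-point lies outside the ball of radius `ρ`; the two end-points are adjacent); with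
  `HalvingQuarterCubeSeq.distBI_ge_of_level_lt`: **`distBI_ge_of_not_near`** for the complement of the interior near class.
* §2 **`rows164_quarter_int`** / **`rows164_quarter_int_top`** — `FlatHBBound164.rows164_quarter` at the cube sequence with
  `near c :↔ j(c) = k ∧ c₋ ∈ □_k^{(k)} ∧ c₊ ∈ □_k^{(k)}`: NEAR size `|X(c)| ≤ C·M_Δ·ε₁·(distBI + 1)` on the interior top bonds, FAR size `|X(c)| ≤ C·M_Δ·ε₀·L^{k−j(c)}` on all
  the others ⟹ (164).
* §3 **`matrixRows164_quarter_int`** — the same for the `𝔤`-valued datum in the three (1.140) letters (duality + the flat stencil dictionary of `HalvingQuarterMatrix`).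
HONEST SCOPE: bookkeeping over the real (164) and this seat's geometry; NOT a claim about the crux, the rung, or the mass gap.

References: T. Bałaban, CMP **102** (1985) 277–309 [Balaban1985Variational] (144) p.300, (154)–(155) p.302, (160)–(164) pp.303–304; CMP **99** (1985) 75–102
[Balaban1985RegularSpaces] (1.30)–(1.31) pp.81–82, (1.140) p.100.
-/

set_option autoImplicit false

noncomputable section

open scoped BigOperators Matrix.Norms.L2Operator

namespace Summit.QuantumFields.YangMills.Theorems.HalvingQuarterInterior

open Literature.MathematicalPhysics.QuantumFieldTheory.Balaban1983to89
open B5Eq117TorusCarriers (Mk)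
open B5Eq118OneStroke (iterBlockOf)
open B5Prop12FieldsLattice (distSite distSite_nonneg)
open B5RowSumsP12Lattice (distSite_comm distSite_triangle)
open B6SectADomainsV1 (Domains)
open B6SectAOperatorsV1 (BondIdx dcE dcsE)
open B8Eq143PlaqExpansion (pdiv)
open B8Eq146AExpansion (plaqCovDeriv)
open B10Eq27TorusAxialLog (pull transl)
open T3ContinuumYM3Torus (T3Family)
open FlatCubeOpsText (distBI IsLevWeight HDecayLetterD RowSum162)
open FlatCubeSequenceAligned (radM cubeFinM cubeSeqM cubeSeqMT3 mem_cubeFinM_of_dist cubeSeqM_Om_pos)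
open FlatPortChart (natCast_add_one_le_distSite)
open FlatOpsLettersAssembly (levWeight_nonneg)
open FlatCubeQContraction (distSite_shift_le_one)
open HalvingQuarterCubeSeq (distBI_nonneg distBI_ge_of_level_lt levWeight_eq_one_of_inOm_top inOm_top_of_dist)
open HalvingQuarterMatrix (norm_le_of_forall_reFunctional re_pdiv_plaqCovDeriv_pull reFunctional_kernel)

/-! ## §1 Top-level index bonds crossing the boundary of the top cube are far -/

section Geometry

variable {P : Params}

/-- **A TOP-LEVEL INDEX BOND WITH AN END-POINT OUTSIDE `□_k^{(k)}` IS FAR**: for `D := cubeSeqM x₀ k hk ρ S M hM` (`1 ≤ k`), a top-level index bond `c` NOT having both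
end-points in `Ω_k^{(k)} = □_k^{(k)}`, and a fine bond `b` whose `k`-block is within `r₀` of the centre block: `distBI D b c ≥ ρ − r₀ − 1` (the outside end-point is beyond the
ball of radius `ρ`, the two end-points are adjacent, triangle inequality). [cite: Balaban1985Variational, (144) p.300, (154) p.302; Balaban1985RegularSpaces, (1.31) p.82] -/
theorem distBI_ge_of_top_not_interior (x₀ : Site P 0) {k : ℕ} (hk : k ≤ P.m + P.K) (hk1 : 1 ≤ k) (ρ S M : ℕ) (hM : 1 ≤ M)
    (c : BondIdx (cubeSeqM x₀ k hk ρ S M hM)) (hc : (c.1.1 : ℕ) = k)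
    (hout : ¬ (c.1.2.src ∈ (cubeSeqM x₀ k hk ρ S M hM).Om (c.1.1 : ℕ) ∧ c.1.2.tgt ∈ (cubeSeqM x₀ k hk ρ S M hM).Om (c.1.1 : ℕ)))
    (b : PBond P 0) {r₀ : ℝ} (hb : distSite (Mk P k) (iterBlockOf k b.src) (iterBlockOf k x₀) ≤ r₀) :
    (ρ : ℝ) - r₀ - 1 ≤ distBI (cubeSeqM x₀ k hk ρ S M hM) b c := by
  unfold distBI
  have hk0 : (cubeSeqM x₀ k hk ρ S M hM).k - (c.1.1 : ℕ) = 0 := by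
    show k - (c.1.1 : ℕ) = 0
    omega
  rw [hk0, pow_zero, one_mul]
  -- points outside `□_k^{(k)}` are beyond the ball of radius `ρ`
  have hOm : (cubeSeqM x₀ k hk ρ S M hM).Om k = cubeFinM x₀ k ρ S M k := cubeSeqM_Om_pos x₀ hk ρ S M hM hk1 le_rfl
  have far_pt : ∀ p : Site P k, p ∉ (cubeSeqM x₀ k hk ρ S M hM).Om k → (ρ : ℝ) + 1 ≤ distSite (Mk P k) p (iterBlockOf k x₀) := by
    intro p hp
    refine natCast_add_one_le_distSite ?_
    by_contra hle
    rw [not_lt] at hle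
    apply hp
    rw [hOm]
    refine mem_cubeFinM_of_dist x₀ k ρ S M k ?_
    rw [Nat.sub_self]
    simpa [radM] using hle
  -- generalise the level of `c` to a variable equal to `k`
  have key : ∀ (i : ℕ) (hi : i = k) (e : PBond P i), (cubeSeqM x₀ k hk ρ S M hM).LamBond i e →
      ¬ (e.src ∈ (cubeSeqM x₀ k hk ρ S M hM).Om i ∧ e.tgt ∈ (cubeSeqM x₀ k hk ρ S M hM).Om i) →
      (ρ : ℝ) - r₀ - 1 ≤ distSite (Mk P i) (iterBlockOf i b.src) e.src := by
    intro i hi e hlam hout'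
    subst hi
    -- the source of `e` is at distance `≥ ρ` from the centre block
    have hsrc : (ρ : ℝ) ≤ distSite (Mk P i) e.src (iterBlockOf i x₀) := by
      by_cases hs : e.src ∈ (cubeSeqM x₀ i hk ρ S M hM).Om i
      · have ht : e.tgt ∉ (cubeSeqM x₀ i hk ρ S M hM).Om i := fun ht => hout' ⟨hs, ht⟩
        have h1 := far_pt e.tgt ht
        have h2 : distSite (Mk P i) e.src e.tgt ≤ 1 := distSite_shift_le_one e.src e.dir
        have htri := distSite_triangle (Mk P i) e.tgt e.src (iterBlockOf i x₀)
        rw [distSite_comm (Mk P i) e.tgt e.src] at htri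
        linarith
      · linarith [far_pt e.src hs]
    have htri := distSite_triangle (Mk P i) e.src (iterBlockOf i b.src) (iterBlockOf i x₀)
    rw [distSite_comm (Mk P i) e.src (iterBlockOf i b.src)] at htri
    linarith
  exact key (c.1.1 : ℕ) hc c.1.2 c.2 hout

/-- **THE COMPLEMENT OF THE INTERIOR NEAR CLASS IS FAR**: every index bond of `cubeSeqM x₀ k hk ρ S M hM` (`1 ≤ k`) that is NOT «top-level with both end-points in
`□_k^{(k)}`» is at `distBI ≥ ρ − r₀ − 1` from every fine bond whose `k`-block is within `r₀` of the centre block (lower levels: `HalvingQuarterCubeSeq.distBI_ge_of_level_lt`).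
[cite: Balaban1985Variational, (144) p.300, (154)-(155) p.302] -/
theorem distBI_ge_of_not_near (x₀ : Site P 0) {k : ℕ} (hk : k ≤ P.m + P.K) (hk1 : 1 ≤ k) (ρ S M : ℕ) (hM : 1 ≤ M)
    (c : BondIdx (cubeSeqM x₀ k hk ρ S M hM))
    (hfar : ¬ ((c.1.1 : ℕ) = k ∧ c.1.2.src ∈ (cubeSeqM x₀ k hk ρ S M hM).Om (c.1.1 : ℕ) ∧ c.1.2.tgt ∈ (cubeSeqM x₀ k hk ρ S M hM).Om (c.1.1 : ℕ)))
    (b : PBond P 0) {r₀ : ℝ} (hb : distSite (Mk P k) (iterBlockOf k b.src) (iterBlockOf k x₀) ≤ r₀) :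
    (ρ : ℝ) - r₀ - 1 ≤ distBI (cubeSeqM x₀ k hk ρ S M hM) b c := by
  by_cases hc : (c.1.1 : ℕ) = k
  · exact distBI_ge_of_top_not_interior x₀ hk hk1 ρ S M hM c hc (fun h => hfar ⟨hc, h⟩) b hb
  · have hlt : (c.1.1 : ℕ) < k := by
      have h1 : (c.1.1 : ℕ) < (cubeSeqM x₀ k hk ρ S M hM).k + 1 := c.1.1.isLt
      have h2 : (cubeSeqM x₀ k hk ρ S M hM).k = k := rfl
      omega
    exact distBI_ge_of_level_lt x₀ hk ρ S M hM c hlt b hb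

end Geometry

/-! ## §2 (164) at the cube sequence with the interior near class -/

section Real164

variable {F : T3Family} {n K : ℕ}

/-- **(164) AT THE CUBE SEQUENCE, INTERIOR NEAR CLASS** (`FlatHBBound164.rows164_quarter` + `distBI_ge_of_not_near`): NEAR size on the top-level index bonds with both
end-points in `□_k^{(k)}`, FAR size `C·M_Δ·ε₀·L^{k−j(c)}` on every other index bond. [cite: Balaban1985Variational, (155) p.302, (160)-(164) pp.303-304] -/
theorem rows164_quarter_int (hnK : n < K) (x₀ : Site (F.P K) 0) (ρ S M : ℕ) (hM : 1 ≤ M)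
    {dBI : PBond (F.P K) 0 → BondIdx (cubeSeqMT3 F n K x₀ ρ S M hM) → ℝ} {w : ℕ → PBond (F.P K) 0 → ℝ}
    {H : (BondIdx (cubeSeqMT3 F n K x₀ ρ S M hM) → ℝ) →ₗ[ℝ] (PBond (F.P K) 0 → ℝ)} {δ₀ B₀ B₃ C MΔ ε₁ ε₀ R₁M₁ r₀ : ℝ}
    (hw : IsLevWeight F n K (cubeSeqMT3 F n K x₀ ρ S M hM) w)
    (hdom : ∀ b c, distBI (cubeSeqMT3 F n K x₀ ρ S M hM) b c ≤ dBI b c)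
    (hH : HDecayLetterD F n K (cubeSeqMT3 F n K x₀ ρ S M hM) dBI w H B₀ δ₀)
    (h162 : RowSum162 F n K (cubeSeqMT3 F n K x₀ ρ S M hM) dBI w δ₀ B₃)
    (hδ₀ : 0 ≤ δ₀) (hB₀ : 0 ≤ B₀) (hB₃ : 0 ≤ B₃) (hC : 0 ≤ C) (hMΔ : 0 ≤ MΔ) (hε₁ : 0 ≤ ε₁) (hε₀ : 0 ≤ ε₀)
    (h163 : 4 * C * B₀ * B₃ * Real.exp (-(δ₀ / 2 * R₁M₁)) ≤ 1 / 2) (hρ : R₁M₁ ≤ (ρ : ℝ) - r₀ - 1)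
    {X : BondIdx (cubeSeqMT3 F n K x₀ ρ S M hM) → ℝ} {b : PBond (F.P K) 0}
    (hb : distSite (Mk (F.P K) (K - n)) (iterBlockOf (K - n) b.src) (iterBlockOf (K - n) x₀) ≤ r₀)
    (hnear : ∀ c : BondIdx (cubeSeqMT3 F n K x₀ ρ S M hM), (c.1.1 : ℕ) = K - n →
      c.1.2.src ∈ (cubeSeqMT3 F n K x₀ ρ S M hM).Om (c.1.1 : ℕ) → c.1.2.tgt ∈ (cubeSeqMT3 F n K x₀ ρ S M hM).Om (c.1.1 : ℕ) →
      |X c| ≤ C * MΔ * ε₁ * (distBI (cubeSeqMT3 F n K x₀ ρ S M hM) b c + 1))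
    (hfar : ∀ c : BondIdx (cubeSeqMT3 F n K x₀ ρ S M hM),
      ¬ ((c.1.1 : ℕ) = K - n ∧ c.1.2.src ∈ (cubeSeqMT3 F n K x₀ ρ S M hM).Om (c.1.1 : ℕ) ∧ c.1.2.tgt ∈ (cubeSeqMT3 F n K x₀ ρ S M hM).Om (c.1.1 : ℕ)) →
      |X c| ≤ C * MΔ * ε₀ * (F.L : ℝ) ^ ((K - n) - (c.1.1 : ℕ))) :
    w 1 b * (w 1 b * |H X b|) ≤ 1 / 4 * MΔ * max (4 * C * B₀ * B₃ * ε₁) (ε₀ / 2) ∧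
    (∀ ν : Fin 3, w 1 b * (w 2 b * (F.L : ℝ) ^ (K - n) * |H X ⟨b.src.shift ν, b.dir⟩ - H X b|) ≤
      1 / 4 * MΔ * max (4 * C * B₀ * B₃ * ε₁) (ε₀ / 2)) ∧
    w 1 b * (w 3 b * |(dcsE ((F.L : ℝ) ^ (K - n)) (dcE ((F.L : ℝ) ^ (K - n)) (WithLp.toLp 2 (H X)))) b|) ≤
      1 / 4 * MΔ * max (4 * C * B₀ * B₃ * ε₁) (ε₀ / 2) ∧
    w 1 b * (w 3 b * ((F.L : ℝ) ^ (K - n)) ^ 2 *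
        |∑ ν : Fin 3, ((H X b - H X ⟨b.src.shift ν, b.dir⟩) + (H X b - H X ⟨b.src.unshift ν, b.dir⟩))|) ≤
      1 / 4 * MΔ * max (4 * C * B₀ * B₃ * ε₁) (ε₀ / 2) := by
  have hCMε₁ : 0 ≤ C * MΔ * ε₁ := by positivity
  have hk1 : 1 ≤ K - n := by omega
  refine FlatHBBound164.rows164_quarter hH h162 hδ₀ hB₀ hB₃ hC hMΔ hε₁ hε₀ h163
    (fun c => (c.1.1 : ℕ) = K - n ∧ c.1.2.src ∈ (cubeSeqMT3 F n K x₀ ρ S M hM).Om (c.1.1 : ℕ) ∧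
      c.1.2.tgt ∈ (cubeSeqMT3 F n K x₀ ρ S M hM).Om (c.1.1 : ℕ))
    (levWeight_nonneg hw 1 b) (fun c => (distBI_nonneg _ b c).trans (hdom b c)) (fun c hc => ?_) (fun c hc => ?_)
  · obtain ⟨hck, hs, ht⟩ := hc
    have hpow : (F.L : ℝ) ^ ((K - n) - (c.1.1 : ℕ)) = 1 := by rw [hck, Nat.sub_self, pow_zero]
    rw [hpow, mul_one]
    calc |X c| ≤ C * MΔ * ε₁ * (distBI (cubeSeqMT3 F n K x₀ ρ S M hM) b c + 1) := hnear c hck hs ht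
      _ ≤ C * MΔ * ε₁ * (dBI b c + 1) := mul_le_mul_of_nonneg_left (by linarith [hdom b c]) hCMε₁
  · exact ⟨hfar c hc, hρ.trans ((distBI_ge_of_not_near x₀ (FlatMinimizerH.le_T3 F n K) hk1 ρ S M hM c hc b hb).trans (hdom b c))⟩

/-- **(164) LITERALLY, INTERIOR NEAR CLASS, ON THE TOP CUBE** (weights `= 1`; `r₀ ≤ ρ`). [cite: Balaban1985Variational, (164) p.304] -/
theorem rows164_quarter_int_top (hnK : n < K) (x₀ : Site (F.P K) 0) (ρ S M : ℕ) (hM : 1 ≤ M)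
    {dBI : PBond (F.P K) 0 → BondIdx (cubeSeqMT3 F n K x₀ ρ S M hM) → ℝ} {w : ℕ → PBond (F.P K) 0 → ℝ}
    {H : (BondIdx (cubeSeqMT3 F n K x₀ ρ S M hM) → ℝ) →ₗ[ℝ] (PBond (F.P K) 0 → ℝ)} {δ₀ B₀ B₃ C MΔ ε₁ ε₀ R₁M₁ r₀ : ℝ}
    (hw : IsLevWeight F n K (cubeSeqMT3 F n K x₀ ρ S M hM) w)
    (hdom : ∀ b c, distBI (cubeSeqMT3 F n K x₀ ρ S M hM) b c ≤ dBI b c)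
    (hH : HDecayLetterD F n K (cubeSeqMT3 F n K x₀ ρ S M hM) dBI w H B₀ δ₀)
    (h162 : RowSum162 F n K (cubeSeqMT3 F n K x₀ ρ S M hM) dBI w δ₀ B₃)
    (hδ₀ : 0 ≤ δ₀) (hB₀ : 0 ≤ B₀) (hB₃ : 0 ≤ B₃) (hC : 0 ≤ C) (hMΔ : 0 ≤ MΔ) (hε₁ : 0 ≤ ε₁) (hε₀ : 0 ≤ ε₀) (hR : 0 ≤ R₁M₁)
    (h163 : 4 * C * B₀ * B₃ * Real.exp (-(δ₀ / 2 * R₁M₁)) ≤ 1 / 2) (hρ : R₁M₁ ≤ (ρ : ℝ) - r₀ - 1)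
    {X : BondIdx (cubeSeqMT3 F n K x₀ ρ S M hM) → ℝ} {b : PBond (F.P K) 0}
    (hb : distSite (Mk (F.P K) (K - n)) (iterBlockOf (K - n) b.src) (iterBlockOf (K - n) x₀) ≤ r₀)
    (hnear : ∀ c : BondIdx (cubeSeqMT3 F n K x₀ ρ S M hM), (c.1.1 : ℕ) = K - n →
      c.1.2.src ∈ (cubeSeqMT3 F n K x₀ ρ S M hM).Om (c.1.1 : ℕ) → c.1.2.tgt ∈ (cubeSeqMT3 F n K x₀ ρ S M hM).Om (c.1.1 : ℕ) →
      |X c| ≤ C * MΔ * ε₁ * (distBI (cubeSeqMT3 F n K x₀ ρ S M hM) b c + 1))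
    (hfar : ∀ c : BondIdx (cubeSeqMT3 F n K x₀ ρ S M hM),
      ¬ ((c.1.1 : ℕ) = K - n ∧ c.1.2.src ∈ (cubeSeqMT3 F n K x₀ ρ S M hM).Om (c.1.1 : ℕ) ∧ c.1.2.tgt ∈ (cubeSeqMT3 F n K x₀ ρ S M hM).Om (c.1.1 : ℕ)) →
      |X c| ≤ C * MΔ * ε₀ * (F.L : ℝ) ^ ((K - n) - (c.1.1 : ℕ))) :
    |H X b| ≤ 1 / 4 * MΔ * max (4 * C * B₀ * B₃ * ε₁) (ε₀ / 2) ∧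
    (∀ ν : Fin 3, (F.L : ℝ) ^ (K - n) * |H X ⟨b.src.shift ν, b.dir⟩ - H X b| ≤ 1 / 4 * MΔ * max (4 * C * B₀ * B₃ * ε₁) (ε₀ / 2)) ∧
    |(dcsE ((F.L : ℝ) ^ (K - n)) (dcE ((F.L : ℝ) ^ (K - n)) (WithLp.toLp 2 (H X)))) b| ≤ 1 / 4 * MΔ * max (4 * C * B₀ * B₃ * ε₁) (ε₀ / 2) ∧
    ((F.L : ℝ) ^ (K - n)) ^ 2 * |∑ ν : Fin 3, ((H X b - H X ⟨b.src.shift ν, b.dir⟩) + (H X b - H X ⟨b.src.unshift ν, b.dir⟩))| ≤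
      1 / 4 * MΔ * max (4 * C * B₀ * B₃ * ε₁) (ε₀ / 2) := by
  have hr : r₀ ≤ (ρ : ℝ) := by linarith
  have hin := inOm_top_of_dist hnK x₀ ρ S M hM hb hr
  have h1 := levWeight_eq_one_of_inOm_top (D := cubeSeqMT3 F n K x₀ ρ S M hM) rfl hw hin
  obtain ⟨r1, r2, r3, r4⟩ := rows164_quarter_int hnK x₀ ρ S M hM hw hdom hH h162 hδ₀ hB₀ hB₃ hC hMΔ hε₁ hε₀ h163 hρ hb hnear hfar
  rw [h1 1] at r1 r2 r3 r4
  rw [h1 2] at r2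
  rw [h1 3] at r3 r4
  refine ⟨by simpa using r1, fun ν => by simpa using r2 ν, by simpa using r3, by simpa using r4⟩

end Real164

/-! ## §3 (164) for the `𝔤`-valued datum with the interior near class -/

section Matrix164

variable {F : T3Family} {n K : ℕ}

/-- **(164) FOR THE `𝔤`-VALUED DATUM, INTERIOR NEAR CLASS** — the three (1.140) letters of `𝔄(b) = Σ_c (He_c)(b)·B(c)` at a fine bond one `r₀` from the centre, from the
NEAR size of `‖B(c)‖` on the interior top-level index bonds and the FAR size on all the others (duality + the flat stencil dictionary of `HalvingQuarterMatrix`).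
[cite: Balaban1985Variational, (159)-(164) pp.303-304; Balaban1985RegularSpaces, (1.140) p.100, (1.31) p.82] -/
theorem matrixRows164_quarter_int (hnK : n < K) (x₀ : Site (F.P K) 0) (ρ S M : ℕ) (hM : 1 ≤ M)
    {dBI : PBond (F.P K) 0 → BondIdx (cubeSeqMT3 F n K x₀ ρ S M hM) → ℝ} {w : ℕ → PBond (F.P K) 0 → ℝ}
    {H : (BondIdx (cubeSeqMT3 F n K x₀ ρ S M hM) → ℝ) →ₗ[ℝ] (PBond (F.P K) 0 → ℝ)} {δ₀ B₀ B₃ C MΔ ε₁ ε₀ R₁M₁ r₀ : ℝ}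
    (hw : IsLevWeight F n K (cubeSeqMT3 F n K x₀ ρ S M hM) w)
    (hdom : ∀ b c, distBI (cubeSeqMT3 F n K x₀ ρ S M hM) b c ≤ dBI b c)
    (hH : HDecayLetterD F n K (cubeSeqMT3 F n K x₀ ρ S M hM) dBI w H B₀ δ₀)
    (h162 : RowSum162 F n K (cubeSeqMT3 F n K x₀ ρ S M hM) dBI w δ₀ B₃)
    (hδ₀ : 0 ≤ δ₀) (hB₀ : 0 ≤ B₀) (hB₃ : 0 ≤ B₃) (hC : 0 ≤ C) (hMΔ : 0 ≤ MΔ) (hε₁ : 0 ≤ ε₁) (hε₀ : 0 ≤ ε₀) (hR : 0 ≤ R₁M₁)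
    (h163 : 4 * C * B₀ * B₃ * Real.exp (-(δ₀ / 2 * R₁M₁)) ≤ 1 / 2) (hρ : R₁M₁ ≤ (ρ : ℝ) - r₀ - 1)
    {B : BondIdx (cubeSeqMT3 F n K x₀ ρ S M hM) → Matrix (Fin 2) (Fin 2) ℂ} {𝔄 : PBond (F.P K) 0 → Matrix (Fin 2) (Fin 2) ℂ}
    (h𝔄 : ∀ b, 𝔄 b = ∑ c, H (Pi.single c 1) b • B c)
    {b : PBond (F.P K) 0} (hb : distSite (Mk (F.P K) (K - n)) (iterBlockOf (K - n) b.src) (iterBlockOf (K - n) x₀) ≤ r₀)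
    (hnear : ∀ c : BondIdx (cubeSeqMT3 F n K x₀ ρ S M hM), (c.1.1 : ℕ) = K - n →
      c.1.2.src ∈ (cubeSeqMT3 F n K x₀ ρ S M hM).Om (c.1.1 : ℕ) → c.1.2.tgt ∈ (cubeSeqMT3 F n K x₀ ρ S M hM).Om (c.1.1 : ℕ) →
      ‖B c‖ ≤ C * MΔ * ε₁ * (distBI (cubeSeqMT3 F n K x₀ ρ S M hM) b c + 1))
    (hfar : ∀ c : BondIdx (cubeSeqMT3 F n K x₀ ρ S M hM),
      ¬ ((c.1.1 : ℕ) = K - n ∧ c.1.2.src ∈ (cubeSeqMT3 F n K x₀ ρ S M hM).Om (c.1.1 : ℕ) ∧ c.1.2.tgt ∈ (cubeSeqMT3 F n K x₀ ρ S M hM).Om (c.1.1 : ℕ)) →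
      ‖B c‖ ≤ C * MΔ * ε₀ * (F.L : ℝ) ^ ((K - n) - (c.1.1 : ℕ))) :
    ‖𝔄 b‖ ≤ 1 / 4 * MΔ * max (4 * C * B₀ * B₃ * ε₁) (ε₀ / 2) ∧
    (∀ κ : Fin 3, (F.L : ℝ) ^ (K - n) * ‖𝔄 ⟨b.src.shift κ, b.dir⟩ - 𝔄 b‖ ≤ 1 / 4 * MΔ * max (4 * C * B₀ * B₃ * ε₁) (ε₀ / 2)) ∧
    ∀ (z : B7Prop1Explicit.Site (F.P K).d) (μ : Fin (F.P K).d), b = ⟨transl 0 z, μ⟩ →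
      ‖pdiv (((F.L : ℝ)⁻¹) ^ (K - n)) (1 : B7Prop1Explicit.Site (F.P K).d → Fin (F.P K).d → (Matrix (Fin 2) (Fin 2) ℂ)ˣ)
          (plaqCovDeriv (((F.L : ℝ)⁻¹) ^ (K - n)) (1 : B7Prop1Explicit.Site (F.P K).d → Fin (F.P K).d → (Matrix (Fin 2) (Fin 2) ℂ)ˣ)
            (pull 𝔄 0)) μ z‖ ≤ 1 / 4 * MΔ * max (4 * C * B₀ * B₃ * ε₁) (ε₀ / 2) := by
  set q : ℝ := 1 / 4 * MΔ * max (4 * C * B₀ * B₃ * ε₁) (ε₀ / 2) with hq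
  have hq0 : 0 ≤ q := by
    have : 0 ≤ max (4 * C * B₀ * B₃ * ε₁) (ε₀ / 2) := le_max_of_le_right (by linarith)
    positivity
  have hLk : (0 : ℝ) < (F.L : ℝ) ^ (K - n) := by
    have : (0 : ℝ) < (F.L : ℝ) := by exact_mod_cast lt_trans zero_lt_one F.hL.2
    positivity
  -- the real (164) for every norm-dominated reading `g`
  have key : ∀ (f : StrongDual ℂ (Matrix (Fin 2) (Fin 2) ℂ)) (u : ℂ) (r : ℝ),
      (∀ y : Matrix (Fin 2) (Fin 2) ℂ, |r * (u * f y).re| ≤ ‖y‖) →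
      |H (fun c => r * (u * f (B c)).re) b| ≤ q ∧
      (∀ ν : Fin 3, (F.L : ℝ) ^ (K - n) * |H (fun c => r * (u * f (B c)).re) ⟨b.src.shift ν, b.dir⟩ - H (fun c => r * (u * f (B c)).re) b| ≤ q) ∧
      |(dcsE ((F.L : ℝ) ^ (K - n)) (dcE ((F.L : ℝ) ^ (K - n)) (WithLp.toLp 2 (H (fun c => r * (u * f (B c)).re))))) b| ≤ q := by
    intro f u r hg
    obtain ⟨r1, r2, r3, -⟩ := rows164_quarter_int_top hnK x₀ ρ S M hM hw hdom hH h162 hδ₀ hB₀ hB₃ hC hMΔ hε₁ hε₀ hR h163 hρ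
      (X := fun c => r * (u * f (B c)).re) hb
      (fun c hc hs ht => (hg (B c)).trans (hnear c hc hs ht)) (fun c hc => (hg (B c)).trans (hfar c hc))
    exact ⟨r1, r2, r3⟩
  refine ⟨?_, fun κ => ?_, fun z μ hbz => ?_⟩
  · refine norm_le_of_forall_reFunctional (𝔄 b) hq0 fun f u r hg => ?_
    rw [reFunctional_kernel H h𝔄 f u r b]
    exact le_of_abs_le (key f u r hg).1
  · have hdiff : ‖𝔄 ⟨b.src.shift κ, b.dir⟩ - 𝔄 b‖ ≤ q / (F.L : ℝ) ^ (K - n) := by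
      refine norm_le_of_forall_reFunctional _ (div_nonneg hq0 hLk.le) fun f u r hg => ?_
      have hlin : r * (u * f (𝔄 ⟨b.src.shift κ, b.dir⟩ - 𝔄 b)).re =
          H (fun c => r * (u * f (B c)).re) ⟨b.src.shift κ, b.dir⟩ - H (fun c => r * (u * f (B c)).re) b := by
        rw [map_sub, mul_sub, Complex.sub_re, mul_sub, reFunctional_kernel H h𝔄 f u r, reFunctional_kernel H h𝔄 f u r]
      have h2 := (key f u r hg).2.1 κ
      have habs : |H (fun c => r * (u * f (B c)).re) ⟨b.src.shift κ, b.dir⟩ - H (fun c => r * (u * f (B c)).re) b| ≤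
          q / (F.L : ℝ) ^ (K - n) := by
        rw [le_div_iff₀ hLk, mul_comm]
        exact h2
      rw [hlin]
      exact (le_abs_self _).trans habs
    calc (F.L : ℝ) ^ (K - n) * ‖𝔄 ⟨b.src.shift κ, b.dir⟩ - 𝔄 b‖ ≤ (F.L : ℝ) ^ (K - n) * (q / (F.L : ℝ) ^ (K - n)) :=
          mul_le_mul_of_nonneg_left hdiff hLk.le
      _ = q := mul_div_cancel₀ q hLk.ne'
  · refine norm_le_of_forall_reFunctional _ hq0 fun f u r hg => ?_
    rw [re_pdiv_plaqCovDeriv_pull]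
    have hfun : (fun b' : PBond (F.P K) 0 => r * (u * f (𝔄 b')).re) = H (fun c => r * (u * f (B c)).re) :=
      funext fun b' => reFunctional_kernel H h𝔄 f u r b'
    have hη : ((((F.L : ℝ)⁻¹) ^ (K - n))⁻¹ : ℝ) = (F.L : ℝ) ^ (K - n) := by rw [inv_pow, inv_inv]
    rw [hfun, hη, ← hbz]
    exact le_of_abs_le (key f u r hg).2.2

end Matrix164

end Summit.QuantumFields.YangMills.Theorems.HalvingQuarterInterior

end
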